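import Summits.CriticalPhenomena.PercolationContinuityZ3.Theorems.PercNearOneGluingNoHeavyLowerTailCILExchangeTools
import Summits.CriticalPhenomena.PercolationContinuityZ3.Theorems.PercNearOneGluingAdditiveGluingOneBond
import HarnessLib

/-!
# `NoHeavyLowerTail` (stmt-CriticalPhenomena-4575) — glue-lead persistence and the forward-greedy step

Support file (prover `prim-lf-3`, lemma factory #3 (submodularity / electrical-network analogies), gen 5;
`--supports stmt-CriticalPhenomena-4575`).  No definitions, no named facts, no sorries.

Bond percolation `μ_w = prodBernoulli w` on `Fin n`, relays `A`, level `j`, `M_v = |{x ∈ A : v ↔ x}|` ("`v` light" = `M_v ≤ j`,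
lightness `I_w(v) = μ_w(M_v ≤ j)`).  Two companions of glue-cost domination `ExchangeTools.glueCost_le` (the lead of a DOMINANT
vertex does not grow when IT is glued onto something):

* `ExchangeTools.glueLead_persist` (**glue-lead persistence**): for vertices `q ≠ h` with `w s(q,h) = 0` and any vertex `p`
  with `I_w(q) ≤ I_w(p)`, gluing the DOMINATED vertex `q` onto `h` keeps it dominated:
  `I_{w[s(q,h)↦1]}(q) ≤ I_{w[s(q,h)↦1]}(p)`.  (Same event bookkeeping as `glueCost_le`: `D_p ⊆ (D_q ∖ W₁) ∪ W₂`, `W₁ ⊆ D_q`;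
  the exchange row ROW-T `observer_row` now enters through `ExchangeTools.sub_le_sub_of_row` in the form
  `μ(X₁) − μ(W₁) ≤ μ(X₂) − μ(W₂)`, `X₁ = {M_q ≤ j < M_p} ⊇ W₁`, `X₂ = {M_p ≤ j < M_q} ⊇ W₂`.)
  Numerically 0 / 7 001 (graph, level, q, h, p) cases (memo `run/shared/lean/prim/prim-lf-3/LF3-HARM.md` §4, lab-gen5/t_dompersist.py).
* `ExchangeTools.forwardGreedy_step` (**pair-deletion persistence = the forward-greedy step**): for vertices `q ≠ o`, any `r`,
  if `q` dominates `r` in `w` (`I_w(r) ≤ I_w(q)`) and `w s(o,q) < 1`, then `q` still dominates `r` after the pair `o–q` is DELETED: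
  `I_{w[s(o,q)↦0]}(r) ≤ I_{w[s(o,q)↦0]}(q)`.  (One-bond decomposition in `t = w s(o,q)` plus `glueLead_persist` in `w[s(o,q)↦0]`:
  were the lead reversed after deletion it would stay reversed after gluing, and the `t`-average could not be `≥ 0`.)

CONSEQUENCE (FG-EXIST, the hypothesis of `AveragedPort.bad_le_firstOpenSum_forward`): for a relay-neighboured observer `o` whose
coins have weight `< 1`, the enumeration "`p 0` := a port of maximal lightness in `w`; `p (l+1)` := a remaining port of maximal
lightness in `w^{[l]}` (= `w` with the pairs `o–p i`, `i ≤ l`, deleted)" is forward-greedy: by `forwardGreedy_step` applied in `w^{[l−1]}`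
the port `p l` dominates every remaining port in `w^{[l]}`.  ttrl2 census `run/shared/lean/ttrl/starm/FGEXIST.md`: 0 failures /
1 489 005 exact instances (the step with the champion of the CURRENT graph: 0 / 1 062 here incl. weight-1 coins).
-/

noncomputable section

namespace Summit.CriticalPhenomena.PercolationContinuityZ3.Theorems

open MeasureTheory Set Literature.Probability.LatticeModels Literature.Probability.Percolation
open scoped Classical BigOperators

variable {n : ℕ}

namespace ExchangeTools

open AttachedChampionObserverExchange

/-- **Glue-lead persistence.**  Vertices `q ≠ h` with `w s(q,h) = 0`, any vertex `p` with `μ_w(M_q ≤ j) ≤ μ_w(M_p ≤ j)`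
(`p` dominates `q`); `w₁ = w[s(q,h) ↦ 1]` (`q` glued onto `h`).  Then `μ_{w₁}(M_q ≤ j) ≤ μ_{w₁}(M_p ≤ j)`: gluing the dominated
vertex onto anything keeps it dominated.  Proof: with `D_v = {M_v ≤ j < M_v(· ∪ {s(q,h)})}` (light before, heavy after),
`W₁ = {h ↔ p, M_q ≤ j < M_p}`, `W₂ = {h ↔ p, M_p ≤ j < M_q}` one has `D_p ⊆ (D_q ∖ W₁) ∪ W₂` and `W₁ ⊆ D_q` (as in
`glueCost_le`), so `μ(D_p) − μ(D_q) ≤ μ(W₂) − μ(W₁) ≤ μ(M_p ≤ j < M_q) − μ(M_q ≤ j < M_p) = μ_w(M_p ≤ j) − μ_w(M_q ≤ j)`, the middle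
step being ROW-T in the integrated form `sub_le_sub_of_row`.
[derived from: VandenbergHaggstromKahn2005, Thm. 1.5, via `AttachedChampionObserverExchange.observer_row`] -/
theorem glueLead_persist (w : Sym2 (Fin n) → unitInterval) (A : Finset (Fin n)) (q h p : Fin n) (j : ℕ)
    (hqh : q ≠ h) (hw0 : w s(q, h) = 0)
    (hdom : (prodBernoulli w).real {ω : BondConfig (Fin n) | (A.filter fun x => ω ∈ openConn q x).card ≤ j} ≤
      (prodBernoulli w).real {ω : BondConfig (Fin n) | (A.filter fun x => ω ∈ openConn p x).card ≤ j}) :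
    (prodBernoulli (Function.update w s(q, h) 1)).real
        {ω : BondConfig (Fin n) | (A.filter fun x => ω ∈ openConn q x).card ≤ j} ≤
      (prodBernoulli (Function.update w s(q, h) 1)).real
        {ω : BondConfig (Fin n) | (A.filter fun x => ω ∈ openConn p x).card ≤ j} := by
  set μ := prodBernoulli w with hμ
  haveI : IsProbabilityMeasure μ := by rw [hμ]; infer_instance
  have hmeas : ∀ s : Set (BondConfig (Fin n)), MeasurableSet s := fun _ => MeasurableSet.of_discrete
  set e : Sym2 (Fin n) := s(q, h) with he
  set ins : BondConfig (Fin n) → BondConfig (Fin n) := fun ω => insert e ω with hins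
  -- opening a pair only adds connections
  have hri : ∀ (ω : BondConfig (Fin n)) (x y : Fin n), (openGraph ω).Reachable x y →
      (openGraph (insert e ω)).Reachable x y := by
    intro ω x y h
    refine h.mono fun u v huv => ?_
    rw [openGraph_adj] at huv ⊢
    exact ⟨Set.mem_insert_of_mem _ huv.1, huv.2⟩
  -- relay counts before / after opening `e`
  set M : Fin n → BondConfig (Fin n) → ℕ := fun v ω => (A.filter fun x => ω ∈ openConn v x).card with hM
  set L : Fin n → Set (BondConfig (Fin n)) := fun v => {ω | M v ω ≤ j} with hL
  set L' : Fin n → Set (BondConfig (Fin n)) := fun v => ins ⁻¹' (L v) with hL'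
  -- the raised measure is the image measure
  have hupd : ∀ v, (prodBernoulli (Function.update w s(q, h) 1)).real
      {ω : BondConfig (Fin n) | (A.filter fun x => ω ∈ openConn v x).card ≤ j} = μ.real (L' v) := by
    intro v
    rw [ChampionStability.real_update_one_eq w hw0]
  rw [hupd p, hupd q]
  change μ.real (L q) ≤ μ.real (L p) at hdom
  change μ.real (L' q) ≤ μ.real (L' p)
  -- monotonicity: L' v ⊆ L v
  have hmono : ∀ v ω, M v ω ≤ M v (ins ω) := by
    intro v ω
    apply card_filter_mono
    intro x _ hx
    exact hri ω _ _ hx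
  have hsub : ∀ v, L' v ⊆ L v := by
    intro v ω hω
    change M v (ins ω) ≤ j at hω
    change M v ω ≤ j
    exact (hmono v ω).trans hω
  have hsd : ∀ s t : Set (BondConfig (Fin n)), t ⊆ s → μ.real s - μ.real t = μ.real (s \ t) := by
    intro s t hts
    have := measureReal_inter_add_sdiff (μ := μ) (s := s) (t := t) (hmeas t)
    rw [inter_eq_right.2 hts] at this
    linarith
  have hdiff : ∀ v, μ.real (L' v) = μ.real (L v) - μ.real (L v \ L' v) := by
    intro v
    have := hsd _ _ (hsub v)
    linarith
  rw [hdiff p, hdiff q]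
  -- the two exchange events and the two one-light-one-heavy events
  set X₁ : Set (BondConfig (Fin n)) :=
    {ω | j < (A.filter fun x => ω ∈ openConn p x).card ∧ (A.filter fun x => ω ∈ openConn q x).card ≤ j} with hX₁
  set X₂ : Set (BondConfig (Fin n)) :=
    {ω | (A.filter fun x => ω ∈ openConn p x).card ≤ j ∧ j < (A.filter fun x => ω ∈ openConn q x).card} with hX₂
  set W₁ : Set (BondConfig (Fin n)) := (openConn h p : Set (BondConfig (Fin n))) ∩ X₁ with hW₁
  set W₂ : Set (BondConfig (Fin n)) := (openConn h p : Set (BondConfig (Fin n))) ∩ X₂ with hW₂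
  -- ROW-T with `o := h`, `b := p`, `q := q`:  μ(W₂) μ(X₁) ≤ μ(W₁) μ(X₂)
  have hrow : μ.real W₂ * μ.real X₁ ≤ μ.real W₁ * μ.real X₂ := observer_row w A h p q j
  -- the lead in `w` is μ(X₂) − μ(X₁)
  have hlead : μ.real (L p) - μ.real (L q) = μ.real X₂ - μ.real X₁ := by
    have hp' : μ.real (L p) = μ.real (L p ∩ L q) + μ.real (L p \ L q) :=
      (measureReal_inter_add_sdiff (μ := μ) (s := L p) (t := L q) (hmeas _)).symm
    have hq' : μ.real (L q) = μ.real (L q ∩ L p) + μ.real (L q \ L p) :=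
      (measureReal_inter_add_sdiff (μ := μ) (s := L q) (t := L p) (hmeas _)).symm
    have e2 : L p \ L q = X₂ := by
      ext ω
      simp only [hL, hM, hX₂, mem_sdiff, mem_setOf_eq, not_le]
    have e1 : L q \ L p = X₁ := by
      ext ω
      simp only [hL, hM, hX₁, mem_sdiff, mem_setOf_eq, not_le]
      tauto
    rw [hp', hq', e2, e1, inter_comm (L q) (L p)]
    ring
  have hX12 : μ.real X₁ ≤ μ.real X₂ := by linarith
  -- integrated row: μ(X₁) − μ(W₁) ≤ μ(X₂) − μ(W₂)
  have hkey : μ.real X₁ - μ.real W₁ ≤ μ.real X₂ - μ.real W₂ :=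
    sub_le_sub_of_row measureReal_nonneg
      (measureReal_mono inter_subset_right (measure_ne_top μ _))
      (measureReal_mono inter_subset_right (measure_ne_top μ _)) hX12 hrow
  -- after opening `e`, `q` reaches everything `p` reaches, provided `h ↔ p`
  have hq_reach : ∀ ω : BondConfig (Fin n), ω ∈ (openConn h p : Set (BondConfig (Fin n))) →
      ∀ x, (openGraph ω).Reachable p x → (openGraph (ins ω)).Reachable q x := by
    intro ω hhp x hpx
    have hhp' : (openGraph ω).Reachable h p := hhp
    have h1 : (openGraph (ins ω)).Reachable q p := by
      rw [hins]
      exact (ChampionStability.reachable_insert_left_iff ω hqh p).2 (Or.inr hhp')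
    exact h1.trans (hri ω _ _ hpx)
  have hMq_ge : ∀ ω : BondConfig (Fin n), ω ∈ (openConn h p : Set (BondConfig (Fin n))) → M p ω ≤ M q (ins ω) := by
    intro ω hhp
    apply card_filter_mono
    intro x _ hx
    exact hq_reach ω hhp x hx
  -- W₁ ⊆ D_q
  have hW1sub : W₁ ⊆ L q \ L' q := by
    rintro ω ⟨hhp, hph, hql⟩
    refine ⟨hql, fun hω => ?_⟩
    change M q (ins ω) ≤ j at hω
    have := hMq_ge ω hhp
    change (A.filter fun x => ω ∈ openConn p x).card ≤ M q (ins ω) at this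
    omega
  -- D_p ⊆ (D_q \ W₁) ∪ W₂
  have hDp : L p \ L' p ⊆ (L q \ L' q) \ W₁ ∪ W₂ := by
    rintro ω ⟨hpl, hpn⟩
    change M p ω ≤ j at hpl
    have hpn' : ¬ M p (ins ω) ≤ j := hpn
    have hnotW1 : ω ∉ W₁ := by
      rintro ⟨_, hph, _⟩
      change j < M p ω at hph
      omega
    by_cases hpq : (openGraph ω).Reachable p q
    · -- same cluster before and after
      left
      refine ⟨⟨?_, fun hω => hpn' ?_⟩, hnotW1⟩
      · change M q ω ≤ j
        have : M p ω = M q ω := card_eq_of_reachable A hpq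
        omega
      · change M q (ins ω) ≤ j at hω
        have hpq' : (openGraph (ins ω)).Reachable p q := hri ω _ _ hpq
        have : M p (ins ω) = M q (ins ω) := card_eq_of_reachable A hpq'
        omega
    · -- p gains relays only through h
      have hph : (openGraph ω).Reachable h p := by
        by_contra hnot
        apply hpn'
        have hpnh : ¬ (openGraph ω).Reachable p h := fun h' => hnot h'.symm
        have key : ∀ x, (openGraph (ins ω)).Reachable p x ↔ (openGraph ω).Reachable p x := by
          intro x
          rw [hins]
          exact ChampionStability.reachable_insert_iff_of_not ω hqh hpq hpnh x
        have : M p (ins ω) = M p ω := by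
          apply le_antisymm
          · exact card_filter_mono A fun x _ hx => (key x).1 hx
          · exact hmono p ω
        omega
      have hhp : ω ∈ (openConn h p : Set (BondConfig (Fin n))) := hph
      by_cases hqh' : M q ω ≤ j
      · -- both light: ω ∈ D_q
        left
        refine ⟨⟨hqh', fun hω => hpn' ?_⟩, hnotW1⟩
        change M q (ins ω) ≤ j at hω
        have hqp' : (openGraph (ins ω)).Reachable q p := by
          rw [hins]; exact (ChampionStability.reachable_insert_left_iff ω hqh p).2 (Or.inr hph)
        have : M p (ins ω) = M q (ins ω) := (card_eq_of_reachable A hqp').symm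
        omega
      · right
        exact ⟨hhp, hpl, not_le.1 hqh'⟩
  -- measure bookkeeping
  have h1 : μ.real (L p \ L' p) ≤ μ.real ((L q \ L' q) \ W₁) + μ.real W₂ :=
    (measureReal_mono hDp (measure_ne_top μ _)).trans (measureReal_union_le _ _)
  have h2 : μ.real ((L q \ L' q) \ W₁) = μ.real (L q \ L' q) - μ.real W₁ :=
    (hsd _ _ hW1sub).symm
  linarith

/-- **Forward-greedy step (pair-deletion persistence).**  Vertices `q ≠ o`, any vertex `r`; if `q` dominates `r` in `w`
(`μ_w(M_r ≤ j) ≤ μ_w(M_q ≤ j)`) and the pair `o–q` has weight `< 1`, then `q` still dominates `r` once that pair is deleted: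
`μ_{w[s(o,q)↦0]}(M_r ≤ j) ≤ μ_{w[s(o,q)↦0]}(M_q ≤ j)`.  Proof: write `t = w s(o,q)`, `w₀ = w[s(o,q)↦0]`, `w₁ = w[s(o,q)↦1] = w₀[s(o,q)↦1]`;
every lightness is `(1−t)·(value at w₀) + t·(value at w₁)` (`stub_oneBondDecomp_k15`); if the lead of `q` over `r` were negative at
`w₀`, `glueLead_persist` (gluing `q` onto `o` in `w₀`) would make it `≤ 0` at `w₁`, hence negative at `w` since `t < 1` — contradiction.
In particular the champion among the ports of an observer `o` dominates every other port in the graph with its own coin deleted,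
which is the step of a forward-greedy enumeration (`AveragedPort.bad_le_firstOpenSum_forward`).
[derived from: VandenbergHaggstromKahn2005, Thm. 1.5, via `glueLead_persist`] -/
theorem forwardGreedy_step (w : Sym2 (Fin n) → unitInterval) (A : Finset (Fin n)) (o q r : Fin n) (j : ℕ)
    (hqo : q ≠ o) (ht : ((w s(o, q) : unitInterval) : ℝ) < 1)
    (hdom : (prodBernoulli w).real {ω : BondConfig (Fin n) | (A.filter fun x => ω ∈ openConn r x).card ≤ j} ≤
      (prodBernoulli w).real {ω : BondConfig (Fin n) | (A.filter fun x => ω ∈ openConn q x).card ≤ j}) :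
    (prodBernoulli (Function.update w s(o, q) 0)).real
        {ω : BondConfig (Fin n) | (A.filter fun x => ω ∈ openConn r x).card ≤ j} ≤
      (prodBernoulli (Function.update w s(o, q) 0)).real
        {ω : BondConfig (Fin n) | (A.filter fun x => ω ∈ openConn q x).card ≤ j} := by
  set e : Sym2 (Fin n) := s(o, q) with he
  set t : ℝ := ((w e : unitInterval) : ℝ) with htdef
  set w₀ := Function.update w e 0 with hw₀
  set w₁ := Function.update w e 1 with hw₁
  set Lr : Set (BondConfig (Fin n)) := {ω | (A.filter fun x => ω ∈ openConn r x).card ≤ j} with hLr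
  set Lq : Set (BondConfig (Fin n)) := {ω | (A.filter fun x => ω ∈ openConn q x).card ≤ j} with hLq
  by_contra hneg
  have hlt : (prodBernoulli w₀).real Lq < (prodBernoulli w₀).real Lr := lt_of_not_ge hneg
  -- glue-lead persistence in `w₀` (there `s(q,o)` has weight 0): the reversed lead survives gluing `q` onto `o`
  have heqo : s(q, o) = e := by rw [he, Sym2.eq_swap]
  have hw0e : w₀ s(q, o) = 0 := by rw [heqo, hw₀, Function.update_self]
  have hpers := glueLead_persist w₀ A q o r j hqo hw0e hlt.le
  have hupd1 : Function.update w₀ s(q, o) 1 = w₁ := by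
    rw [heqo, hw₀, hw₁, Function.update_idem]
  rw [hupd1] at hpers
  -- one-bond decomposition of both lightnesses in the weight of `e`
  have hdr := stub_oneBondDecomp_k15 n w e Lr
  have hdq := stub_oneBondDecomp_k15 n w e Lq
  rw [← htdef, ← hw₀, ← hw₁] at hdr hdq
  change (prodBernoulli w).real Lr ≤ (prodBernoulli w).real Lq at hdom
  rw [hdr, hdq] at hdom
  have ht0 : 0 ≤ t := by rw [htdef]; exact unitInterval.nonneg _
  have h1t : 0 < 1 - t := by linarith
  have hA : (1 - t) * (prodBernoulli w₀).real Lq < (1 - t) * (prodBernoulli w₀).real Lr :=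
    mul_lt_mul_of_pos_left hlt h1t
  have hB : t * (prodBernoulli w₁).real Lq ≤ t * (prodBernoulli w₁).real Lr :=
    mul_le_mul_of_nonneg_left hpers ht0
  linarith

end ExchangeTools

end Summit.CriticalPhenomena.PercolationContinuityZ3.Theorems

end
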